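/-
Copyright (c) 2026 The H21 project. Released under Apache 2.0 license.
-/
import Summits.RiemannHypothesis.RiemannHypothesis.Theorems.PfPersistenceGalerkinMarkovAtCutoff
import Summits.RiemannHypothesis.RiemannHypothesis.Theorems.PfPersistenceGalerkinNegIndexApprox
import Literature.NumberTheory.LFunctions.WeilLogLatticeComb
import HarnessLib

/-!
# `P_F` persistence — GAL-4 preparation: the Gram expansion of `Re Q` and a LINEAR smoothing of window vectors
# with simultaneous form control (cand-3, gen 11)

Mechanism / rigidity campaign of the `pub-rhpf` cell (variational seat M2 = cand-3); NO claim about RH is made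
anywhere in this file.  Everything here is RH-free and sorry-free; no numerical datum is used (all PROVED).

The converse Galerkin comparison GAL-4 (`PfPersistenceGalerkinIndexLaw`: a negative-definite `n`-space of the
even block of `ζ` at a window `(a, N)` yields `n` smooth even real tests on `[-a, a]` spanning a negative-definite
subspace of `Re Q`) needs a smoothing of window vectors that is LINEAR — so that the smoothing of `∑ cᵢ vᵢ` is
`∑ cᵢ`·(smoothing of `vᵢ`) and cross terms are controlled — together with the expansion of `Re Q` on real
combinations of tests as the quadratic form of a Gram matrix.  The tree's density statements
(`cutoffProfileFormDensity`, `exists_even_mollified_seq`) are per-vector existentials; this file supplies the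
linear version.

* §1 `weilCross g h = W(g ⋆ h̃)`, the sesquilinear cross term of `Q` (`Q(g) = weilCross g g`); additivity and
  homogeneity in each slot on test functions; finite sums; the GRAM EXPANSION
  `Q(∑ cᵢ gᵢ) = ∑ᵢⱼ cᵢ c̄ⱼ W(gᵢ ⋆ g̃ⱼ)` and, for real coefficients, `Re Q(∑ cᵢ gᵢ) = cᵀ (Re W(gᵢ ⋆ g̃ⱼ)) c`.
* §2 `linApprox win n k v := (1_{[-bₙ, bₙ]} θ_v) ⋆ φ_k` — barrier-prover's truncate-then-mollify construction of
  `cutoffProfileFormDensity` with the radius `bₙ = a - a/(n+2)` and the bump mollifier `φ_k` FIXED: linear in `v`,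
  a Weil test function, even, real-valued, supported in `[-a, a]` once `r_k ≤ a - bₙ`.
* §3 `linApprox_formDense` — for every FINITE family of window vectors and `δ > 0` ONE pair `(n, k)` with
  `r_k < a - bₙ` makes `|Re Q(linApprox win n k w) - wᵀ A_{(a,N)} w| ≤ δ` for every member `w` (the form part of
  `cutoffProfileFormDensity` run with `Filter.eventually_all`, and cand-3's window-matrix identity
  `galerkinMatrixIdentity`).
-/

set_option linter.dupNamespace false

noncomputable section

open Complex Filter Set MeasureTheory Topology Matrix Finset
open scoped Real ComplexConjugate

namespace Summit.RiemannHypothesis.RiemannHypothesis.Theorems.PfPersistence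

open Literature.NumberTheory.LFunctions Literature.NumberTheory.LFunctions.WeilContinuous

/-! ## §1 The cross term of `Q` and the Gram expansion -/

/-- the SESQUILINEAR CROSS TERM `W(g ⋆ h̃)` of Weil's quadratic functional (`Q(g) = weilCross g g`). [folklore] -/
def weilCross (g h : ℝ → ℂ) : ℂ := weilFunctional (weilConv g (weilReflect h))

/-- PROVED: `Q(g) = W(g ⋆ g̃)` is the diagonal of the cross term. [folklore] -/
theorem weilQuadratic_eq_weilCross (g : ℝ → ℂ) : weilQuadratic g = weilCross g g := rfl

section Cross

variable {g g₁ g₂ h h₁ h₂ : ℝ → ℂ}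

/-- PROVED: additivity of the cross term in the first slot (test functions). [folklore] -/
theorem weilCross_add_left (hg₁ : IsWeilTest g₁) (hg₂ : IsWeilTest g₂) (hh : IsWeilTest h) :
    weilCross (g₁ + g₂) h = weilCross g₁ h + weilCross g₂ h := by
  unfold weilCross
  rw [weilConv_add_left hg₁ hg₂ hh.weilReflect,
    weilFunctional_add (hg₁.weilConv hh.weilReflect) (hg₂.weilConv hh.weilReflect)]

/-- PROVED: additivity of the cross term in the second slot (test functions). [folklore] -/
theorem weilCross_add_right (hg : IsWeilTest g) (hh₁ : IsWeilTest h₁) (hh₂ : IsWeilTest h₂) :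
    weilCross g (h₁ + h₂) = weilCross g h₁ + weilCross g h₂ := by
  unfold weilCross
  rw [weilReflect_add, weilConv_add_right hg hh₁.weilReflect hh₂.weilReflect,
    weilFunctional_add (hg.weilConv hh₁.weilReflect) (hg.weilConv hh₂.weilReflect)]

/-- PROVED: homogeneity in the first slot (no hypotheses). [folklore] -/
theorem weilCross_const_mul_left (c : ℂ) (g h : ℝ → ℂ) :
    weilCross (fun t ↦ c * g t) h = c * weilCross g h := by
  unfold weilCross
  rw [weilConv_const_mul_left, weilFunctional_const_mul]

/-- PROVED: conjugate-homogeneity in the second slot (no hypotheses). [folklore] -/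
theorem weilCross_const_mul_right (c : ℂ) (g h : ℝ → ℂ) :
    weilCross g (fun t ↦ c * h t) = conj c * weilCross g h := by
  unfold weilCross
  rw [weilReflect_const_mul, weilConv_const_mul_right, weilFunctional_const_mul]

/-- PROVED: the cross term of a finite combination in the first slot. [folklore] -/
theorem weilCross_sum_left {ι : Type*} (s : Finset ι) {G : ι → ℝ → ℂ} (hG : ∀ i, IsWeilTest (G i))
    (hh : IsWeilTest h) (c : ι → ℂ) :
    weilCross (fun t ↦ ∑ i ∈ s, c i * G i t) h = ∑ i ∈ s, c i * weilCross (G i) h := by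
  classical
  induction s using Finset.induction_on with
  | empty =>
    have h0 : (fun t : ℝ ↦ ∑ i ∈ (∅ : Finset ι), c i * G i t) = fun t ↦ (0 : ℂ) * h t := by
      funext t
      rw [Finset.sum_empty, zero_mul]
    rw [h0, weilCross_const_mul_left, zero_mul, Finset.sum_empty]
  | insert a s ha ih =>
    have h1 : (fun t : ℝ ↦ ∑ i ∈ insert a s, c i * G i t) =
        (fun t ↦ c a * G a t) + fun t ↦ ∑ i ∈ s, c i * G i t := by
      funext t
      rw [Finset.sum_insert ha]
      rfl
    have hs : IsWeilTest fun t ↦ ∑ i ∈ s, c i * G i t :=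
      isWeilTest_finset_sum s fun i _ ↦ (hG i).const_mul (c i)
    rw [h1, weilCross_add_left ((hG a).const_mul (c a)) hs hh, weilCross_const_mul_left, ih,
      Finset.sum_insert ha]

/-- PROVED: the cross term of a finite combination in the second slot. [folklore] -/
theorem weilCross_sum_right {ι : Type*} (s : Finset ι) (hg : IsWeilTest g) {H : ι → ℝ → ℂ}
    (hH : ∀ j, IsWeilTest (H j)) (d : ι → ℂ) :
    weilCross g (fun t ↦ ∑ j ∈ s, d j * H j t) = ∑ j ∈ s, conj (d j) * weilCross g (H j) := by
  classical
  induction s using Finset.induction_on with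
  | empty =>
    have h0 : (fun t : ℝ ↦ ∑ j ∈ (∅ : Finset ι), d j * H j t) = fun t ↦ (0 : ℂ) * g t := by
      funext t
      rw [Finset.sum_empty, zero_mul]
    rw [h0, weilCross_const_mul_right, map_zero, zero_mul, Finset.sum_empty]
  | insert a s ha ih =>
    have h1 : (fun t : ℝ ↦ ∑ j ∈ insert a s, d j * H j t) =
        (fun t ↦ d a * H a t) + fun t ↦ ∑ j ∈ s, d j * H j t := by
      funext t
      rw [Finset.sum_insert ha]
      rfl
    have hs : IsWeilTest fun t ↦ ∑ j ∈ s, d j * H j t :=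
      isWeilTest_finset_sum s fun j _ ↦ (hH j).const_mul (d j)
    rw [h1, weilCross_add_right hg ((hH a).const_mul (d a)) hs, weilCross_const_mul_right, ih,
      Finset.sum_insert ha]

end Cross

/-- **PROVED — THE GRAM EXPANSION OF WEIL'S QUADRATIC FUNCTIONAL**: `Q(∑ cᵢ gᵢ) = ∑ᵢ ∑ⱼ cᵢ c̄ⱼ W(gᵢ ⋆ g̃ⱼ)`
for test functions `gᵢ` and complex coefficients. [cite: Bombieri2000Weil, §3 (the hermitian form attached to T)] -/
theorem weilQuadratic_sum_eq_sum_weilCross {ι : Type*} (s : Finset ι) {G : ι → ℝ → ℂ}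
    (hG : ∀ i, IsWeilTest (G i)) (c : ι → ℂ) :
    weilQuadratic (fun t ↦ ∑ i ∈ s, c i * G i t) =
      ∑ i ∈ s, ∑ j ∈ s, c i * conj (c j) * weilCross (G i) (G j) := by
  have hs : IsWeilTest fun t ↦ ∑ j ∈ s, c j * G j t :=
    isWeilTest_finset_sum s fun j _ ↦ (hG j).const_mul (c j)
  rw [weilQuadratic_eq_weilCross, weilCross_sum_left s hG hs c]
  refine Finset.sum_congr rfl fun i _ ↦ ?_
  rw [weilCross_sum_right s (hG i) hG c, Finset.mul_sum]
  exact Finset.sum_congr rfl fun j _ ↦ by ring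

/-- the REAL GRAM MATRIX `(Re W(gᵢ ⋆ g̃ⱼ))ᵢⱼ` of a finite family. [folklore] -/
def reGram {n : ℕ} (g : Fin n → ℝ → ℂ) : Matrix (Fin n) (Fin n) ℝ :=
  Matrix.of fun i j ↦ (weilCross (g i) (g j)).re

/-- **PROVED — `Re Q` ON REAL COMBINATIONS IS THE QUADRATIC FORM OF THE REAL GRAM MATRIX**:
`Re Q(∑ cᵢ gᵢ) = cᵀ (Re W(gᵢ ⋆ g̃ⱼ))ᵢⱼ c` for real `c`. [folklore] -/
theorem re_weilQuadratic_sum_real {n : ℕ} {g : Fin n → ℝ → ℂ} (hg : ∀ i, IsWeilTest (g i)) (c : Fin n → ℝ) :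
    (weilQuadratic (fun t : ℝ ↦ ∑ i, (c i : ℂ) * g i t)).re = c ⬝ᵥ (reGram g *ᵥ c) := by
  rw [weilQuadratic_sum_eq_sum_weilCross _ hg, form_eq_sum_sum, Complex.re_sum]
  refine Finset.sum_congr rfl fun i _ ↦ ?_
  rw [Complex.re_sum]
  refine Finset.sum_congr rfl fun j _ ↦ ?_
  rw [Complex.conj_ofReal, ← Complex.ofReal_mul, Complex.re_ofReal_mul]
  simp only [reGram, Matrix.of_apply]

/-! ## §2 The linear smoothing of window vectors -/

section CutProfile

variable (L b : ℝ) {N : ℕ} (v : Fin (N + 1) → ℝ)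

/-- PROVED: the truncated profile is integrable. [folklore] -/
theorem integrable_cutoffAt_profileC : Integrable (cutoffAt b (profileC L v)) :=
  integrable_cutoffAt (continuous_profileC L v) b

/-- PROVED: the truncated profile has compact support. [folklore] -/
theorem hasCompactSupport_cutoffAt_profileC : HasCompactSupport (cutoffAt b (profileC L v)) :=
  HasCompactSupport.intro isCompact_Icc fun _ hx ↦ indicator_of_notMem hx _

/-- PROVED: the truncated profile vanishes outside the radius. [folklore] -/
theorem cutoffAt_profileC_eq_zero {u : ℝ} (hu : b < |u|) : cutoffAt b (profileC L v) u = 0 :=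
  indicator_of_notMem (fun h ↦ by have := abs_le.2 ⟨h.1, h.2⟩; linarith) _

/-- PROVED: the truncated profile is even. [folklore] -/
theorem cutoffAt_profileC_neg (x : ℝ) : cutoffAt b (profileC L v) (-x) = cutoffAt b (profileC L v) x := by
  by_cases hx : x ∈ Icc (-b) b
  · have hnx : -x ∈ Icc (-b) b := ⟨by linarith [hx.2], by linarith [hx.1]⟩
    simp only [cutoffAt, indicator_of_mem hx, indicator_of_mem hnx, profileC, CollarBound.profile_neg_arg]
  · have hnx : -x ∉ Icc (-b) b := fun h ↦ hx ⟨by linarith [h.2], by linarith [h.1]⟩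
    simp only [cutoffAt, indicator_of_notMem hx, indicator_of_notMem hnx]

/-- PROVED: the truncated profile is real-valued. [folklore] -/
theorem cutoffAt_profileC_eq_ofReal (u : ℝ) :
    cutoffAt b (profileC L v) u = (((Icc (-b) b).indicator (profile L v) u : ℝ) : ℂ) := by
  by_cases hu : u ∈ Icc (-b) b
  · simp only [cutoffAt, indicator_of_mem hu, profileC]
  · simp only [cutoffAt, indicator_of_notMem hu, Complex.ofReal_zero]

/-- PROVED: the truncated profile is bounded. [folklore] -/
theorem exists_bound_cutoffAt_profileC : ∃ C : ℝ, ∀ x, ‖cutoffAt b (profileC L v) x‖ ≤ C := by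
  obtain ⟨M, hMb⟩ :=
    isCompact_Icc.exists_bound_of_continuousOn (s := Icc (-b) b) (continuous_profileC L v).continuousOn
  refine ⟨max M 0, fun x ↦ ?_⟩
  by_cases hx : x ∈ Icc (-b) b
  · simp only [cutoffAt, indicator_of_mem hx]
    exact (hMb x hx).trans (le_max_left _ _)
  · simp only [cutoffAt, indicator_of_notMem hx, norm_zero]
    exact le_max_right _ _

/-- PROVED: the complex profile is linear in the coefficient vector. [folklore] -/
theorem profileC_sum_smul {m : ℕ} (c : Fin m → ℝ) (w : Fin m → Fin (N + 1) → ℝ) (x : ℝ) :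
    profileC L (∑ i, c i • w i) x = ∑ i, (c i : ℂ) * profileC L (w i) x := by
  simp only [profileC, profile_sum_smul, Complex.ofReal_sum, Complex.ofReal_mul]

/-- PROVED: the truncated profile is linear in the coefficient vector. [folklore] -/
theorem cutoffAt_profileC_sum_smul {m : ℕ} (c : Fin m → ℝ) (w : Fin m → Fin (N + 1) → ℝ) (u : ℝ) :
    cutoffAt b (profileC L (∑ i, c i • w i)) u = ∑ i, (c i : ℂ) * cutoffAt b (profileC L (w i)) u := by
  by_cases hu : u ∈ Icc (-b) b
  · simp only [cutoffAt, indicator_of_mem hu, profileC_sum_smul]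
  · simp only [cutoffAt, indicator_of_notMem hu, mul_zero, Finset.sum_const_zero]

end CutProfile

/-- the LINEAR SMOOTHING of a window vector at radius index `n` and mollifier index `k`:
`(1_{[-bₙ, bₙ]} θ_v) ⋆ φ_k` with `bₙ = a - a/(n+2)` (`radiusSeq`) and the bump mollifier `φ_k` (`moll`) — the
construction of `cutoffProfileFormDensity` with its two indices held fixed. [folklore] -/
def linApprox (win : Window) (n k : ℕ) (v : Fin (win.N + 1) → ℝ) : ℝ → ℂ :=
  weilConv (cutoffAt (radiusSeq win.a n) (profileC (2 * win.a) v)) (moll k)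

section LinApprox

variable (win : Window) (n k : ℕ) (v : Fin (win.N + 1) → ℝ)

/-- PROVED: the smoothing is a Weil test function. [folklore] -/
theorem isWeilTest_linApprox : IsWeilTest (linApprox win n k v) :=
  isWeilTest_weilConv_moll_of_locallyIntegrable (integrable_cutoffAt_profileC _ _ v).locallyIntegrable
    (hasCompactSupport_cutoffAt_profileC _ _ v) k

/-- PROVED: the smoothing is even. [folklore] -/
theorem linApprox_neg (t : ℝ) : linApprox win n k v (-t) = linApprox win n k v t :=
  weilConv_moll_neg (cutoffAt_profileC_neg _ _ v) k t

/-- PROVED: the smoothing is real-valued. [folklore] -/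
theorem linApprox_im (t : ℝ) : (linApprox win n k v t).im = 0 := by
  have hint : (fun u ↦ cutoffAt (radiusSeq win.a n) (profileC (2 * win.a) v) u * moll k (t - u)) =
      fun u ↦ ((((Icc (-radiusSeq win.a n) (radiusSeq win.a n)).indicator (profile (2 * win.a) v) u *
        (bump k).normed volume (t - u) : ℝ) : ℂ)) := by
    funext u
    rw [cutoffAt_profileC_eq_ofReal, moll, ← Complex.ofReal_mul]
  rw [linApprox, weilConv_apply, hint, integral_complex_ofReal]
  exact Complex.ofReal_im _

/-- PROVED: the smoothing is supported in `[-(bₙ + r_k), bₙ + r_k]`. [folklore] -/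
theorem tsupport_linApprox_subset_radius :
    tsupport (linApprox win n k v) ⊆
      Icc (-(radiusSeq win.a n + (bump k).rOut)) (radiusSeq win.a n + (bump k).rOut) :=
  tsupport_weilConv_moll_subset (fun _ hu ↦ cutoffAt_profileC_eq_zero _ _ v hu) k

/-- PROVED: once `r_k ≤ a - bₙ` the smoothing is supported in the window `[-a, a]`. [folklore] -/
theorem tsupport_linApprox_subset (hk : (bump k).rOut ≤ win.a - radiusSeq win.a n) :
    tsupport (linApprox win n k v) ⊆ Icc (-win.a) win.a :=
  (tsupport_linApprox_subset_radius win n k v).trans (Icc_subset_Icc (by linarith) (by linarith))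

/-- **PROVED — THE SMOOTHING IS LINEAR IN THE WINDOW VECTOR**:
`linApprox (∑ cᵢ vᵢ) = ∑ cᵢ · linApprox vᵢ` pointwise. [folklore] -/
theorem linApprox_sum_smul {m : ℕ} (c : Fin m → ℝ) (w : Fin m → Fin (win.N + 1) → ℝ) (t : ℝ) :
    linApprox win n k (∑ i, c i • w i) t = ∑ i, (c i : ℂ) * linApprox win n k (w i) t := by
  simp only [linApprox, weilConv_apply]
  have hint : ∀ i, Integrable fun u ↦
      cutoffAt (radiusSeq win.a n) (profileC (2 * win.a) (w i)) u * moll k (t - u) := fun i ↦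
    integrable_cutoffAt_mul (continuous_profileC _ (w i)) _
      ((continuous_moll k).comp (continuous_const.sub continuous_id))
  calc ∫ u, cutoffAt (radiusSeq win.a n) (profileC (2 * win.a) (∑ i, c i • w i)) u * moll k (t - u)
      = ∫ u, ∑ i, (c i : ℂ) *
          (cutoffAt (radiusSeq win.a n) (profileC (2 * win.a) (w i)) u * moll k (t - u)) := by
        refine integral_congr_ae (Eventually.of_forall fun u ↦ ?_)
        simp only [cutoffAt_profileC_sum_smul, Finset.sum_mul]
        exact Finset.sum_congr rfl fun i _ ↦ mul_assoc _ _ _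
    _ = ∑ i, ∫ u, (c i : ℂ) *
          (cutoffAt (radiusSeq win.a n) (profileC (2 * win.a) (w i)) u * moll k (t - u)) :=
        integral_finsetSum _ fun i _ ↦ (hint i).const_mul _
    _ = ∑ i, (c i : ℂ) * ∫ u, cutoffAt (radiusSeq win.a n) (profileC (2 * win.a) (w i)) u * moll k (t - u) :=
        Finset.sum_congr rfl fun i _ ↦ integral_const_mul _ _

end LinApprox

/-! ## §3 Simultaneous form control on a finite family -/

/-- **PROVED — SIMULTANEOUS LINEAR FORM DENSITY.**  For every window `(a, N)`, every FINITE family `w` of window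
vectors and every `δ > 0` there is ONE pair of indices `(n, k)` with `r_k < a - bₙ` (so every `linApprox win n k u`
is an even real test supported in `[-a, a]`) such that `|Re Q(linApprox win n k (w l)) - (w l)ᵀ A_{(a,N)} (w l)| ≤ δ`
for every member `w l`: the form part of `cutoffProfileFormDensity` with the two `Tendsto`s made uniform over
the finite family (`Filter.eventually_all`) and the window-matrix identity `vᵀ A v = Re Q(1_{[-a,a]} θ_v)`
(`galerkinMatrixIdentity`). RH-free. [folklore] -/
theorem linApprox_formDense (win : Window) {ι : Type*} [Finite ι] (w : ι → Fin (win.N + 1) → ℝ) {δ : ℝ}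
    (hδ : 0 < δ) :
    ∃ n k : ℕ, (bump k).rOut < win.a - radiusSeq win.a n ∧
      ∀ l, |(weilQuadratic (linApprox win n k (w l))).re - w l ⬝ᵥ (zetaDatum win *ᵥ w l)| ≤ δ := by
  have ha : 0 < win.a := win.ha
  have hθd : ∀ l x, HasDerivAt (profileC (2 * win.a) (w l))
      (((deriv (fun y ↦ profile (2 * win.a) (w l) y) x : ℝ) : ℂ)) x := fun l ↦ hasDerivAt_profileC _ _
  have hθ' : ∀ l, Continuous fun x ↦ ((deriv (fun y ↦ profile (2 * win.a) (w l) y) x : ℝ) : ℂ) := fun l ↦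
    continuous_deriv_profileC _ _
  have hθc : ∀ l, Continuous (profileC (2 * win.a) (w l)) := fun l ↦ continuous_profileC _ _
  -- STEP 1: one radius for the whole family
  have h1 : ∀ l, ∀ᶠ n : ℕ in atTop,
      dist (weilFunctional (autocorrAt (radiusSeq win.a n) (profileC (2 * win.a) (w l))))
        (weilFunctional (autocorrAt win.a (profileC (2 * win.a) (w l)))) < δ / 2 := fun l ↦
    Metric.tendsto_nhds.1 (tendsto_form_and_mass_cutoffAt (hθd l) (hθ' l) (b := radiusSeq win.a)
      (B := win.a) (fun n ↦ radiusSeq_mem ha.le n) ⟨ha.le, le_rfl⟩ (tendsto_radiusSeq win.a)).1 _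
      (by positivity)
  obtain ⟨n, hn⟩ := (eventually_all.2 h1).exists
  have hb0 : 0 < radiusSeq win.a n := radiusSeq_pos ha n
  have hba : radiusSeq win.a n < win.a := radiusSeq_lt ha n
  -- STEP 2: one mollifier index for the whole family, inside the window
  have hAc : ∀ l, Continuous (autocorrAt (radiusSeq win.a n) (profileC (2 * win.a) (w l))) := fun l ↦
    continuous_weilConv_weilReflect_cutoff (hθc l) _
  have hAs : ∀ l, HasCompactSupport (autocorrAt (radiusSeq win.a n) (profileC (2 * win.a) (w l))) :=
    fun l ↦ hasCompactSupport_weilConv_weilReflect_cutoff _ _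
  have hAA := fun l ↦ integrable_weilArchIntegrand_autocorrAt (hθd l) (hθ' l) hb0.le
  have h3 : ∀ l, ∀ᶠ k : ℕ in atTop,
      dist (weilFunctional (weilConv (autocorrAt (radiusSeq win.a n) (profileC (2 * win.a) (w l))) (mollSq k)))
        (weilFunctional (autocorrAt (radiusSeq win.a n) (profileC (2 * win.a) (w l)))) < δ / 2 := fun l ↦
    Metric.tendsto_nhds.1 (tendsto_weilFunctional_mollSq (hAc l) (hAs l) (hAA l)) _ (by positivity)
  have h5 : ∀ᶠ k : ℕ in atTop, (bump k).rOut < win.a - radiusSeq win.a n := by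
    refine (Metric.tendsto_nhds.1 tendsto_bump_rOut (win.a - radiusSeq win.a n) (by linarith)).mono
      fun k hk ↦ ?_
    rw [Real.dist_eq, sub_zero] at hk
    exact (abs_lt.1 hk).2
  obtain ⟨k, hk3, hk5⟩ := ((eventually_all.2 h3).and h5).exists
  refine ⟨n, k, hk5, fun l ↦ ?_⟩
  -- the form estimate for the member `w l`
  have hFm : Measurable (cutoffAt (radiusSeq win.a n) (profileC (2 * win.a) (w l))) :=
    (hθc l).measurable.indicator measurableSet_Icc
  obtain ⟨C, hC⟩ := exists_bound_cutoffAt_profileC (2 * win.a) (radiusSeq win.a n) (w l)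
  have e3 : weilQuadratic (linApprox win n k (w l)) =
      weilFunctional (weilConv (autocorrAt (radiusSeq win.a n) (profileC (2 * win.a) (w l))) (mollSq k)) :=
    weilQuadratic_weilConv_moll hFm (integrable_cutoffAt_profileC _ _ _)
      (hasCompactSupport_cutoffAt_profileC _ _ _) hC k
  have e4 : weilQuadratic (cutoffProfile win (w l)) =
      weilFunctional (autocorrAt win.a (profileC (2 * win.a) (w l))) := by
    rw [cutoffProfile_eq_indicator win (w l)]
    rfl
  have d3 : ‖weilQuadratic (linApprox win n k (w l)) -
      weilFunctional (autocorrAt (radiusSeq win.a n) (profileC (2 * win.a) (w l)))‖ < δ / 2 := by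
    rw [e3, ← dist_eq_norm]
    exact hk3 l
  have d4 : ‖weilFunctional (autocorrAt (radiusSeq win.a n) (profileC (2 * win.a) (w l))) -
      weilQuadratic (cutoffProfile win (w l))‖ < δ / 2 := by
    rw [e4, ← dist_eq_norm]
    exact hn l
  rw [(galerkinMatrixIdentity win (w l)).1]
  calc |(weilQuadratic (linApprox win n k (w l))).re - (weilQuadratic (cutoffProfile win (w l))).re|
      = |(weilQuadratic (linApprox win n k (w l)) - weilQuadratic (cutoffProfile win (w l))).re| := by
        rw [Complex.sub_re]
    _ ≤ ‖weilQuadratic (linApprox win n k (w l)) - weilQuadratic (cutoffProfile win (w l))‖ :=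
        Complex.abs_re_le_norm _
    _ = ‖(weilQuadratic (linApprox win n k (w l)) -
            weilFunctional (autocorrAt (radiusSeq win.a n) (profileC (2 * win.a) (w l)))) +
          (weilFunctional (autocorrAt (radiusSeq win.a n) (profileC (2 * win.a) (w l))) -
            weilQuadratic (cutoffProfile win (w l)))‖ := by
        congr 1
        ring
    _ ≤ ‖weilQuadratic (linApprox win n k (w l)) -
            weilFunctional (autocorrAt (radiusSeq win.a n) (profileC (2 * win.a) (w l)))‖ +
          ‖weilFunctional (autocorrAt (radiusSeq win.a n) (profileC (2 * win.a) (w l))) -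
            weilQuadratic (cutoffProfile win (w l))‖ := norm_add_le _ _
    _ ≤ δ := by linarith

end Summit.RiemannHypothesis.RiemannHypothesis.Theorems.PfPersistence
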